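import Mathlib
import HarnessLib

/-!
# The degree filtration on a uniform product space `[m]^N` and the Keller–Lifshitz–Marcus level-`d` inequality for biglobal functions (named fact)

Sources: N. Keller, N. Lifshitz, O. Marcus, *Sharp hypercontractivity for global functions*,
arXiv:2307.01356 = J. Eur. Math. Soc. (2026) doi:10.4171/jems/1762 [KellerLifshitzMarcus2023], §2.2
(product spaces, Efron–Stein decomposition, `f^{=d}`) and **Theorem 5.4** (p. 48 of the arXiv version,
read first-hand: "Let `f : Ωⁿ → ℝ`. Let `γ₂ > γ₁ > 0`, `r > 1`, and `d ≤ ½ log(γ₂/γ₁)`, and suppose that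
for all sets `S ⊂ [n]` with `|S| ≤ d` and for all `x ∈ Ω^S`, we have `‖f_{S→x}‖₁ ≤ r^{|S|} γ₁` and
`‖f_{S→x}‖₂ ≤ r^{|S|} γ₂`. Then `‖f^{=d}‖₂² ≤ γ₁² (2200 r² log(γ₂/γ₁)/d)^d`."); P. Keevash, N. Lifshitz,
arXiv:2307.15030 [KeevashLifshitz2023], §1.4–1.5 (the same theorem quoted for the uniform product space
`[n]^n` as "Theorem 1.6 ([keller2023])", and the degree filtration `V_{≤d}` = span of `d`-juntas,
`f^{=d} = f^{≤d} − f^{≤d−1}`), held text `paper:arxiv-2307.15030` p. 10–11.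

Fourth brick of the programme (cell pnp-psdrank memo LIT-26, Milestone M) to prove the `S_n` layer of
Keevash–Lifshitz Thm 3.1 ⇒ 1.8 (tree facts `GlobalLevelDInequalityBiglobal`, `GlobalLevelDInequality`)
on top of ONE product-space theorem. This file is the `[m]^N` side, mirroring the tree's
`Literature/Combinatorics/Additive/GlobalLevelInequality.lean` (`SnSpace`, `degLE`, `projLE`, `levelPart`):

* `XSpace N m = EuclideanSpace ℝ (Fin N → Fin m)` with the COUNTING inner product (the papers'
  expectation norms are these divided by `m^N`); `vecX`, cylinder sets `cylinder S y = {x : x =_S y}` and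
  their indicator vectors;
* `degLEX N m d` — KL §1.4 "`V_{≤d}` … the span of all functions of degree at most `d`", a function having
  degree `≤ d` iff it is a combination of `d`-juntas; a `d`-junta is a combination of indicators of cylinders
  on `≤ d` coordinates, so `V_{≤d}` = span of cylinder indicators with `|S| ≤ d` (the form typed here);
  `projLEX` = orthogonal projection `f ↦ f^{≤d}`, `levelPartX d f = f^{=d} := f^{≤d} − f^{≤d−1}`
  (= the Efron–Stein degree-`d` part `Σ_{|T|=d} f^{=T}`, KLM §2.2, since `V_{≤d} = ⊕_{|T|≤d} V^{=T}`);
  PROVED API: monotonicity, `f^{=d} ∈ V_{≤d}`, `f^{=d} ⊥ V_{≤d−1}`, and the PYTHAGORAS identity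
  `‖f^{≤d}‖² = Σ_{i≤d} ‖f^{=i}‖²` (`norm_projLEX_sq_eq_sum`);
* `IsBiglobalX r γ₁ γ₂ d h` — the hypothesis of KLM Thm 5.4 = KL Def. 1.4 on `[m]^N` (restrictions
  `h_{S→y}` have `‖·‖₁ ≤ r^{|S|}γ₁`, `‖·‖₂ ≤ r^{|S|}γ₂` in the uniform measure on the cylinder), with cleared
  denominators;
* NAMED FACT `KellerLifshitzMarcus2023_thm54` — Theorem 5.4 SPECIALISED to the uniform measure on
  `[m]^N` (the paper: an arbitrary finite probability space `(Ω, μ)` and its product measure; the consumer —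
  Keevash–Lifshitz's coupling argument — needs exactly `Ω = [n]` uniform, `N = n`), transcribed with
  `‖f^{=d}‖₂² = ‖levelPartX d (vecX h)‖²/m^N`, `log = Real.log`, `d⁻¹ = 1/d` (at `d = 0` both sides read
  `(E h)² ≤ γ₁²`, true since `|E h| ≤ E|h| ≤ γ₁`), and the printed constant `2200`;
  -- TODO(general form): arbitrary finite probability spaces `(Ω, μ)` (needs product measures on `Ω^N`).
* PROVED consumer form `sum_levelPartX_sq_le` / `norm_projLEX_sq_le`: under the fact, for biglobal `h`
  and `1 ≤ d ≤ ½ log(γ₂/γ₁)`, `‖h^{≤d}‖²/m^N ≤ 2 γ₁² (2200 r² d⁻¹ log(γ₂/γ₁))^d` ("each summand is at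
  least twice the previous", KL Lemma 3.6).

Debt note (D-0026): ONE new named fact (a theorem of a refereed 2026 JEMS paper); it is the declared
external input (A) of the programme whose last brick discharges the tree's two Keevash–Lifshitz facts
(net −2 + 1). No instances, no notation; standard axioms. WHAT THIS IS NOT: not a proof of KLM Thm 5.4;
nothing about `S_n`, matchings or psd rank; no P-vs-NP content.
-/

noncomputable section

namespace Literature.Combinatorics.Additive.ProductSpace

open Finset
open scoped InnerProductSpace

variable {N m : ℕ}

/-! ## `L²([m]^N)` with the counting inner product -/

/-- `L²([m]^N)` as a Euclidean space (counting inner product; the papers' expectation inner product is this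
divided by `m^N`). [cite: KeevashLifshitz2023, §1.4 ("the space `L²([n]^n)` … with uniform measure")] -/
abbrev XSpace (N m : ℕ) : Type := EuclideanSpace ℝ (Fin N → Fin m)

/-- A real function on `[m]^N` as a vector. [cite: KeevashLifshitz2023, §1.4] -/
def vecX (h : (Fin N → Fin m) → ℝ) : XSpace N m := WithLp.toLp 2 h

/-- [cite: KeevashLifshitz2023, §1.4] -/
@[simp] theorem vecX_apply (h : (Fin N → Fin m) → ℝ) (x : Fin N → Fin m) : vecX h x = h x := rfl

/-- [cite: KeevashLifshitz2023, §1.4] -/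
theorem inner_eq_sum (u v : XSpace N m) : ⟪u, v⟫_ℝ = ∑ x, u x * v x := by
  rw [PiLp.inner_apply]
  exact sum_congr rfl fun x _ => by simp [mul_comm]

/-- [cite: KeevashLifshitz2023, §1.4] -/
theorem norm_sq_eq_sum (u : XSpace N m) : ‖u‖ ^ 2 = ∑ x, u x ^ 2 := by
  rw [EuclideanSpace.norm_eq, Real.sq_sqrt (by positivity)]
  exact sum_congr rfl fun x _ => by simp [sq_abs]

/-- The **cylinder** of `y` on the coordinates `S`: `{x : x_i = y_i ∀ i ∈ S}` (the domain of the restriction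
`h_{S→y}`). [cite: KellerLifshitzMarcus2023, §2.1 ("the restriction `f_{S→x}`")] -/
def cylinder (S : Finset (Fin N)) (y : Fin N → Fin m) : Finset (Fin N → Fin m) :=
  univ.filter fun x => ∀ i ∈ S, x i = y i

/-- [cite: KellerLifshitzMarcus2023, §2.1] -/
theorem mem_cylinder {S : Finset (Fin N)} {y x : Fin N → Fin m} : x ∈ cylinder S y ↔ ∀ i ∈ S, x i = y i := by
  simp [cylinder]

/-- The indicator vector of a set of points. [cite: KeevashLifshitz2023, §1.4] -/
def indX (A : Finset (Fin N → Fin m)) : XSpace N m := vecX fun x => if x ∈ A then 1 else 0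

/-- [cite: KeevashLifshitz2023, §1.4] -/
@[simp] theorem indX_apply (A : Finset (Fin N → Fin m)) (x : Fin N → Fin m) :
    indX A x = if x ∈ A then 1 else 0 := rfl

/-! ## The degree filtration (KL §1.4 / KLM §2.2) -/

/-- **`V_{≤d}`** on `[m]^N`: the span of the `d`-juntas, i.e. of the indicators of cylinders on at most `d`
coordinates. [cite: KeevashLifshitz2023, §1.4 ("`V_{≤d}` … the span of all functions of degree at most `d`")] -/
def degLEX (N m d : ℕ) : Submodule ℝ (XSpace N m) :=
  Submodule.span ℝ {v : XSpace N m | ∃ S : Finset (Fin N), S.card ≤ d ∧ ∃ y : Fin N → Fin m, v = indX (cylinder S y)}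

/-- [cite: KeevashLifshitz2023, §1.4] -/
theorem indX_cylinder_mem_degLEX {S : Finset (Fin N)} {d : ℕ} (hS : S.card ≤ d) (y : Fin N → Fin m) :
    indX (cylinder S y) ∈ degLEX N m d :=
  Submodule.subset_span ⟨S, hS, y, rfl⟩

/-- [cite: KeevashLifshitz2023, §1.4] -/
theorem degLEX_mono {d d' : ℕ} (h : d ≤ d') : degLEX N m d ≤ degLEX N m d' := by
  apply Submodule.span_mono
  rintro v ⟨S, hS, y, rfl⟩
  exact ⟨S, hS.trans h, y, rfl⟩

/-- A `d`-JUNTA (a function of `x|_S`, `|S| ≤ d`) lies in `V_{≤d}`: it is the combination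
`Σ_{x} h(x)/|cyl| · 1_{cyl_S(x)}` of cylinder indicators. [cite: KeevashLifshitz2023, §1.4 ("a `d`-junta … only depends on `d` variables")] -/
theorem vecX_mem_degLEX_of_junta {S : Finset (Fin N)} {d : ℕ} (hS : S.card ≤ d) (h : (Fin N → Fin m) → ℝ)
    (hh : ∀ x x' : Fin N → Fin m, (∀ i ∈ S, x i = x' i) → h x = h x') : vecX h ∈ degLEX N m d := by
  classical
  -- `h = Σ_{x} (h x / |cylinder S x|) • 1_{cylinder S x}`
  have key : vecX h = ∑ x : Fin N → Fin m, (h x / ((cylinder S x).card : ℝ)) • indX (cylinder S x) := by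
    ext z
    simp only [vecX_apply]
    rw [WithLp.ofLp_sum]
    simp only [Finset.sum_apply, WithLp.ofLp_smul, Pi.smul_apply, smul_eq_mul]
    -- the terms with `z ∈ cylinder S x` are those with `x ∈ cylinder S z`, all equal to `h z / |cyl S z|`
    have hsame : ∀ x : Fin N → Fin m, x ∈ cylinder S z →
        h x / ((cylinder S x).card : ℝ) * (indX (cylinder S x)).ofLp z = h z / ((cylinder S z).card : ℝ) := by
      intro x hx
      rw [mem_cylinder] at hx
      have hzx : z ∈ cylinder S x := mem_cylinder.2 fun i hi => (hx i hi).symm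
      have hcyl : cylinder S x = cylinder S z := by
        ext w; rw [mem_cylinder, mem_cylinder]
        constructor
        · intro hw i hi; rw [hw i hi, hx i hi]
        · intro hw i hi; rw [hw i hi, ← hx i hi]
      have : (indX (cylinder S x)).ofLp z = 1 := by
        show (if z ∈ cylinder S x then (1 : ℝ) else 0) = 1
        rw [if_pos hzx]
      rw [this, mul_one, hh x z hx, hcyl]
    have hzero : ∀ x : Fin N → Fin m, x ∉ cylinder S z →
        h x / ((cylinder S x).card : ℝ) * (indX (cylinder S x)).ofLp z = 0 := by
      intro x hx
      have hzx : z ∉ cylinder S x := fun hz => hx (mem_cylinder.2 fun i hi => ((mem_cylinder.1 hz) i hi).symm)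
      have : (indX (cylinder S x)).ofLp z = 0 := by
        show (if z ∈ cylinder S x then (1 : ℝ) else 0) = 0
        rw [if_neg hzx]
      rw [this, mul_zero]
    rw [← sum_filter_add_sum_filter_not univ (fun x => x ∈ cylinder S z),
      show (∑ x ∈ univ.filter (fun x => ¬ x ∈ cylinder S z),
        h x / ((cylinder S x).card : ℝ) * (indX (cylinder S x)).ofLp z) = 0 from
        sum_eq_zero fun x hx => hzero x (mem_filter.1 hx).2, add_zero,
      sum_congr rfl (fun x hx => hsame x (mem_filter.1 hx).2), sum_const, nsmul_eq_mul]
    have hc : (0 : ℝ) < ((univ.filter fun x => x ∈ cylinder S z).card : ℝ) := by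
      have : z ∈ univ.filter fun x => x ∈ cylinder S z := by
        rw [mem_filter]; exact ⟨mem_univ _, mem_cylinder.2 fun _ _ => rfl⟩
      exact_mod_cast card_pos.2 ⟨z, this⟩
    have : (univ.filter fun x => x ∈ cylinder S z) = cylinder S z := by ext x; simp
    rw [this] at hc ⊢
    field_simp
  rw [key]
  exact Submodule.sum_mem _ fun x _ => Submodule.smul_mem _ _ (indX_cylinder_mem_degLEX hS x)

/-- **`f ↦ f^{≤d}`**, the orthogonal projection onto `V_{≤d}`. [cite: KeevashLifshitz2023, §1.4] -/
def projLEX (N m d : ℕ) : XSpace N m →L[ℝ] XSpace N m := (degLEX N m d).starProjection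

/-- [cite: KeevashLifshitz2023, §1.4] -/
theorem projLEX_mem (d : ℕ) (f : XSpace N m) : projLEX N m d f ∈ degLEX N m d :=
  (degLEX N m d).starProjection_apply_mem f

/-- [cite: KeevashLifshitz2023, §1.4] -/
theorem inner_sub_projLEX_eq_zero (d : ℕ) (f : XSpace N m) {w : XSpace N m} (hw : w ∈ degLEX N m d) :
    ⟪f - projLEX N m d f, w⟫_ℝ = 0 :=
  (degLEX N m d).starProjection_inner_eq_zero f w hw

/-- `f^{≤d} = f` for `f ∈ V_{≤d}`. [cite: KeevashLifshitz2023, §1.4] -/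
theorem projLEX_eq_self {d : ℕ} {f : XSpace N m} (hf : f ∈ degLEX N m d) : projLEX N m d f = f :=
  (degLEX N m d).starProjection_eq_self_iff.2 hf

/-- **The degree-`d` part** `f^{=d} := f^{≤d} − f^{≤d−1}` (`f^{=0} := f^{≤0}`); equals the Efron–Stein
`Σ_{|T| = d} f^{=T}`. [cite: KeevashLifshitz2023, §1.4 ("`f^{=d} = f^{≤d} − f^{≤d−1}`")] -/
def levelPartX (N m d : ℕ) (f : XSpace N m) : XSpace N m :=
  if d = 0 then projLEX N m 0 f else projLEX N m d f - projLEX N m (d - 1) f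

/-- [cite: KeevashLifshitz2023, §1.4] -/
theorem levelPartX_mem (d : ℕ) (f : XSpace N m) : levelPartX N m d f ∈ degLEX N m d := by
  unfold levelPartX
  split_ifs with hd
  · subst hd; exact projLEX_mem 0 f
  · exact Submodule.sub_mem _ (projLEX_mem d f) (degLEX_mono (Nat.sub_le d 1) (projLEX_mem (d - 1) f))

/-- `f^{=d} ⊥ V_{≤d−1}` for `d ≥ 1`. [cite: KeevashLifshitz2023, §1.4] -/
theorem inner_levelPartX_eq_zero {d : ℕ} (hd : 1 ≤ d) (f : XSpace N m) {w : XSpace N m}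
    (hw : w ∈ degLEX N m (d - 1)) : ⟪levelPartX N m d f, w⟫_ℝ = 0 := by
  unfold levelPartX
  rw [if_neg (by omega)]
  have h1 := inner_sub_projLEX_eq_zero (d - 1) f hw
  have h2 := inner_sub_projLEX_eq_zero d f (degLEX_mono (Nat.sub_le d 1) hw)
  have : projLEX N m d f - projLEX N m (d - 1) f = (f - projLEX N m (d - 1) f) - (f - projLEX N m d f) := by abel
  rw [this, inner_sub_left, h1, h2, sub_zero]

/-- Telescoping: `f^{≤d} = f^{≤d−1} + f^{=d}` (`d ≥ 1`). [cite: KeevashLifshitz2023, §1.4] -/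
theorem projLEX_succ (d : ℕ) (f : XSpace N m) :
    projLEX N m (d + 1) f = projLEX N m d f + levelPartX N m (d + 1) f := by
  unfold levelPartX
  rw [if_neg (by omega), Nat.add_sub_cancel]
  abel

/-- **Pythagoras along the degree filtration**: `‖f^{≤d}‖² = Σ_{i≤d} ‖f^{=i}‖²`.
[cite: KellerLifshitzMarcus2023, Lemma 2.1 (1) (orthogonality of the Efron–Stein parts)] -/
theorem norm_projLEX_sq_eq_sum (d : ℕ) (f : XSpace N m) :
    ‖projLEX N m d f‖ ^ 2 = ∑ i ∈ range (d + 1), ‖levelPartX N m i f‖ ^ 2 := by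
  induction d with
  | zero =>
    rw [sum_range_one]
    unfold levelPartX
    rw [if_pos rfl]
  | succ d ih =>
    rw [sum_range_succ, ← ih, projLEX_succ]
    -- cross term vanishes: `f^{=d+1} ⊥ V_{≤d} ∋ f^{≤d}`
    have horth : ⟪projLEX N m d f, levelPartX N m (d + 1) f⟫_ℝ = 0 := by
      rw [real_inner_comm]
      exact inner_levelPartX_eq_zero (by omega) f (by rw [Nat.add_sub_cancel]; exact projLEX_mem d f)
    have := norm_add_sq_real (projLEX N m d f) (levelPartX N m (d + 1) f)
    rw [horth, mul_zero, add_zero] at this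
    exact this

/-! ## Biglobal functions and the Keller–Lifshitz–Marcus level-`d` inequality -/

/-- **`(r, γ₁, γ₂, d)`-biglobal function on `[m]^N`** (KL Def. 1.4 / the hypothesis of KLM Thm 5.4): for all
`S` with `|S| ≤ d` and all `y`, the restriction `h_{S→y}` (a function on the cylinder, uniform measure) has
`‖h_{S→y}‖₁ ≤ r^{|S|} γ₁` and `‖h_{S→y}‖₂ ≤ r^{|S|} γ₂`; with cleared denominators (`|cylinder| = m^{N−|S|}`):
`Σ_{x ∈ cyl} |h x| ≤ r^{|S|} γ₁ m^{N−|S|}` and `Σ_{x ∈ cyl} (h x)² ≤ (r^{|S|} γ₂)² m^{N−|S|}`.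
[cite: KeevashLifshitz2023, Def. 1.4] [cite: KellerLifshitzMarcus2023, Thm. 5.4 (hypothesis)] -/
def IsBiglobalX (r γ₁ γ₂ : ℝ) (d : ℕ) (h : (Fin N → Fin m) → ℝ) : Prop :=
  ∀ S : Finset (Fin N), S.card ≤ d → ∀ y : Fin N → Fin m,
    (∑ x ∈ cylinder S y, |h x|) ≤ r ^ S.card * γ₁ * (m : ℝ) ^ (N - S.card) ∧
    (∑ x ∈ cylinder S y, h x ^ 2) ≤ (r ^ S.card * γ₂) ^ 2 * (m : ℝ) ^ (N - S.card)

/-- Monotonicity in the depth `d`. [cite: KeevashLifshitz2023, Def. 1.4] -/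
theorem IsBiglobalX.mono {r γ₁ γ₂ : ℝ} {d d' : ℕ} {h : (Fin N → Fin m) → ℝ} (hh : IsBiglobalX r γ₁ γ₂ d h)
    (hd : d' ≤ d) : IsBiglobalX r γ₁ γ₂ d' h :=
  fun S hS y => hh S (hS.trans hd) y

/-- **Keller–Lifshitz–Marcus, sharp level-`d` inequality for biglobal functions** (arXiv:2307.01356 =
J. Eur. Math. Soc. 2026, **Theorem 5.4**; quoted by Keevash–Lifshitz as their Theorem 1.6), SPECIALISED to
the uniform product measure on `[m]^N`: "Let `f : Ωⁿ → ℝ`. Let `γ₂ > γ₁ > 0`, `r > 1`, and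
`d ≤ ½ log(γ₂/γ₁)`, and suppose that for all sets `S ⊂ [n]` with `|S| ≤ d` and for all `x ∈ Ω^S`, we have
`‖f_{S→x}‖₁ ≤ r^{|S|} γ₁` and `‖f_{S→x}‖₂ ≤ r^{|S|} γ₂`. Then `‖f^{=d}‖₂² ≤ γ₁² (2200 r² log(γ₂/γ₁)/d)^d`."
Here `Ω = [m]` uniform, `n = N`, `‖f^{=d}‖₂² = ‖levelPartX N m d (vecX h)‖²/m^N` (expectation norm;
`f^{=d} = f^{≤d} − f^{≤d−1}` is the Efron–Stein degree-`d` part since `V_{≤d} = ⊕_{|T|≤d} V^{=T}`),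
`log = Real.log`, `d⁻¹ = 1/d`, constant `2200` as printed. NAMED FACT, not proved in the tree (proof:
KLM §4–§5, sharp hypercontractivity for global functions on product spaces).
-- TODO(general form): an arbitrary finite probability space `(Ω, μ)` in place of uniform `[m]`.
[cite: KellerLifshitzMarcus2023, Thm. 5.4] [cite: KeevashLifshitz2023, Thm. 1.6 (quotation for `[n]^n`)] -/
def KellerLifshitzMarcus2023_thm54 : Prop :=
  ∀ (N m : ℕ) (h : (Fin N → Fin m) → ℝ) (r γ₁ γ₂ : ℝ) (d : ℕ),
    1 < r → 0 < γ₁ → γ₁ < γ₂ → (d : ℝ) ≤ Real.log (γ₂ / γ₁) / 2 →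
    IsBiglobalX r γ₁ γ₂ d h →
    ‖levelPartX N m d (vecX h)‖ ^ 2 / (m : ℝ) ^ N ≤
      γ₁ ^ 2 * (2200 * r ^ 2 * (1 / (d : ℝ)) * Real.log (γ₂ / γ₁)) ^ d

/-! ## The consumer form: the low-degree mass of a biglobal function (KL Lemma 3.6, product-space half) -/

/-- "Each summand is at least twice the previous": for `c·L ≥ 6(i+1)`,
`2 (cL/i)^i ≤ (cL/(i+1))^{i+1}` (with `(cL/0)^0 = 1`), via `(1 + 1/i)^i ≤ e ≤ 3`.
[cite: KeevashLifshitz2023, Lemma 3.6 (proof: "each summand is at least twice the previous")] -/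
theorem two_mul_pow_le_pow_succ {c : ℝ} (hc : 0 < c) (i : ℕ) (hci : 6 * ((i : ℝ) + 1) ≤ c) :
    2 * (c * (1 / (i : ℝ))) ^ i ≤ (c * (1 / ((i : ℝ) + 1))) ^ (i + 1) := by
  rcases Nat.eq_zero_or_pos i with rfl | hi
  · simp; linarith
  have hi' : (0 : ℝ) < i := by exact_mod_cast hi
  -- `(i+1)^{i+1} ≤ 3 (i+1) i^i`
  have hexp : ((i : ℝ) + 1) ^ i ≤ 3 * (i : ℝ) ^ i := by
    have h1 : ((i : ℝ) + 1) / i ≤ Real.exp (1 / i) := by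
      rw [show ((i : ℝ) + 1) / i = 1 / i + 1 by rw [add_div, div_self hi'.ne', add_comm]]
      exact Real.add_one_le_exp _
    have h2 : (((i : ℝ) + 1) / i) ^ i ≤ Real.exp 1 := by
      calc (((i : ℝ) + 1) / i) ^ i ≤ (Real.exp (1 / i)) ^ i := pow_le_pow_left₀ (by positivity) h1 i
        _ = Real.exp 1 := by rw [← Real.exp_nat_mul]; congr 1; field_simp
    have h3 : Real.exp 1 ≤ 3 := by
      have := Real.exp_one_lt_d9; norm_num at this; linarith
    rw [div_pow, div_le_iff₀ (by positivity)] at h2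
    linarith [h2, mul_le_mul_of_nonneg_right h3 (pow_nonneg hi'.le i)]
  rw [mul_pow, mul_pow, pow_succ c, one_div_pow, one_div_pow]
  -- goal: 2 c^i / i^i ≤ c^i c / (i+1)^{i+1}
  have hpos : (0 : ℝ) < ((i : ℝ) + 1) ^ (i + 1) := by positivity
  have hipos : (0 : ℝ) < (i : ℝ) ^ i := by positivity
  have key : 2 * c ^ i / (i : ℝ) ^ i ≤ c ^ i * c / ((i : ℝ) + 1) ^ (i + 1) := by
    rw [div_le_div_iff₀ hipos hpos, pow_succ]
    calc 2 * c ^ i * (((i : ℝ) + 1) ^ i * ((i : ℝ) + 1))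
        ≤ 2 * c ^ i * (3 * (i : ℝ) ^ i * ((i : ℝ) + 1)) := by gcongr
      _ = c ^ i * (6 * ((i : ℝ) + 1)) * (i : ℝ) ^ i := by ring
      _ ≤ c ^ i * c * (i : ℝ) ^ i := by gcongr
  calc 2 * (c ^ i * (1 / (i : ℝ) ^ i)) = 2 * c ^ i / (i : ℝ) ^ i := by ring
    _ ≤ c ^ i * c / ((i : ℝ) + 1) ^ (i + 1) := key
    _ = c ^ i * c * (1 / ((i : ℝ) + 1) ^ (i + 1)) := by ring

/-- The geometric consequence: `Σ_{i=0}^{d} (cL/i)^i ≤ 2 (cL/d)^d` when `cL ≥ 6d`... precisely when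
`6(i+1) ≤ c` for all `i < d`. [cite: KeevashLifshitz2023, Lemma 3.6 (proof)] -/
theorem sum_pow_le_two_mul {c : ℝ} (hc : 0 < c) (d : ℕ) (hcd : 6 * (d : ℝ) ≤ c) :
    ∑ i ∈ range (d + 1), (c * (1 / (i : ℝ))) ^ i ≤ 2 * (c * (1 / (d : ℝ))) ^ d := by
  induction d with
  | zero => simp
  | succ d ih =>
    have hcd' : 6 * (d : ℝ) ≤ c := by push_cast at hcd; linarith
    rw [sum_range_succ]
    have h2 := two_mul_pow_le_pow_succ hc d (by push_cast at hcd; linarith)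
    push_cast
    linarith [ih hcd']

/-- **The low-degree mass of a biglobal function** (product-space half of KL Lemma 3.6): under the KLM
fact, a `(r, γ₁, γ₂, d)`-biglobal `h` on `[m]^N` with `r > 1`, `γ₂ > γ₁ > 0`, `1 ≤ d ≤ ½ log(γ₂/γ₁)` has
`‖h^{≤d}‖₂² = Σ_{i ≤ d} ‖h^{=i}‖₂² ≤ 2 γ₁² (2200 r² d⁻¹ log(γ₂/γ₁))^d` (expectation norms).
[cite: KeevashLifshitz2023, Lemma 3.6] -/
theorem norm_projLEX_sq_le (hKLM : KellerLifshitzMarcus2023_thm54) {h : (Fin N → Fin m) → ℝ}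
    {r γ₁ γ₂ : ℝ} {d : ℕ} (hr : 1 < r) (hγ₁ : 0 < γ₁) (hγ : γ₁ < γ₂)
    (hd : (d : ℝ) ≤ Real.log (γ₂ / γ₁) / 2) (hh : IsBiglobalX r γ₁ γ₂ d h) :
    ‖projLEX N m d (vecX h)‖ ^ 2 / (m : ℝ) ^ N ≤
      2 * γ₁ ^ 2 * (2200 * r ^ 2 * (1 / (d : ℝ)) * Real.log (γ₂ / γ₁)) ^ d := by
  rw [norm_projLEX_sq_eq_sum, sum_div]
  -- termwise KLM
  have hterm : ∀ i ∈ range (d + 1), ‖levelPartX N m i (vecX h)‖ ^ 2 / (m : ℝ) ^ N ≤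
      γ₁ ^ 2 * (2200 * r ^ 2 * (1 / (i : ℝ)) * Real.log (γ₂ / γ₁)) ^ i := by
    intro i hi
    rw [mem_range] at hi
    have hid : i ≤ d := by omega
    exact hKLM N m h r γ₁ γ₂ i hr hγ₁ hγ (le_trans (by exact_mod_cast hid) hd) (hh.mono hid)
  refine (sum_le_sum hterm).trans ?_
  -- the geometric sum
  set c : ℝ := 2200 * r ^ 2 * Real.log (γ₂ / γ₁) with hcdef
  have hlog : 0 ≤ Real.log (γ₂ / γ₁) := Real.log_nonneg (by rw [le_div_iff₀ hγ₁]; linarith)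
  have hc : 0 < c ∨ d = 0 := by
    rcases Nat.eq_zero_or_pos d with hd0 | hd0
    · exact Or.inr hd0
    · left
      have : (0 : ℝ) < Real.log (γ₂ / γ₁) := by
        have : (1 : ℝ) ≤ d := by exact_mod_cast hd0
        linarith
      positivity
  rcases hc with hc | hd0
  · have hcd : 6 * (d : ℝ) ≤ c := by
      have hr2 : (1 : ℝ) ≤ r ^ 2 := one_le_pow₀ hr.le
      have : 2 * (d : ℝ) ≤ Real.log (γ₂ / γ₁) := by linarith
      calc 6 * (d : ℝ) ≤ 3 * Real.log (γ₂ / γ₁) := by linarith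
        _ ≤ 2200 * r ^ 2 * Real.log (γ₂ / γ₁) := by nlinarith
    have key := sum_pow_le_two_mul hc d hcd
    calc ∑ i ∈ range (d + 1), γ₁ ^ 2 * (2200 * r ^ 2 * (1 / (i : ℝ)) * Real.log (γ₂ / γ₁)) ^ i
        = γ₁ ^ 2 * ∑ i ∈ range (d + 1), (c * (1 / (i : ℝ))) ^ i := by
          rw [mul_sum]; refine sum_congr rfl fun i _ => ?_; rw [hcdef]; ring
      _ ≤ γ₁ ^ 2 * (2 * (c * (1 / (d : ℝ))) ^ d) := by gcongr
      _ = 2 * γ₁ ^ 2 * (2200 * r ^ 2 * (1 / (d : ℝ)) * Real.log (γ₂ / γ₁)) ^ d := by rw [hcdef]; ring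
  · subst hd0
    simp
    linarith [sq_nonneg γ₁]

end Literature.Combinatorics.Additive.ProductSpace

end
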